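import Literature.MeasureTheory.Group.InvariantQuotientNormalized     -- ★ `quotientMeasure`, `eq_unfoldingConstant_smul_quotientMeasure`, `lintegral_fiberLIntegral_quotientMeasure`, `lintegral_fiberLIntegral_eq_mul_lintegral`
import HarnessLib

/-!
# The canonical quotient measure is LINEAR in the Haar measure of the big group: `(c • ν) ∕ ρ = c • (ν ∕ ρ)`
(Deitmar–Echterhoff, *Principles of Harmonic Analysis* (2014), Thm. 1.5.3; Folland (1995), §2.6 (2.52))

Topic `MeasureTheory/Group`; namespace `Literature.MeasureTheory.Group`; THEOREMS ONLY (no definition, no instance visible to importers, no named fact, no `sorry`).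
The quotient measure `ν ∕ ρ = quotientMeasure H ρ ν` of ★ `InvariantQuotientExistence` is pinned by Weil's formula with constant one; replacing `ν` by `c • ν` (`c ≠ 0`)
multiplies it by `c`: **`quotientMeasure_smul_measure`** (uniqueness ★ `eq_unfoldingConstant_smul_quotientMeasure` + Weil's formula on the indicator of a positive compact), with
the integral readings `lintegral_quotientMeasure_smul_measure`, `integral_quotientMeasure_smul_measure`.  The companion of ★ `quotientMeasure_eq_inv_smul_of_eq_smul`
(`ArchEndoscopicChartOrbFree`: `ν ∕ (κ • ρ) = κ⁻¹ • ν ∕ ρ`).  Used by the hodgecm line LH3 (crux `stmt-HodgeConjecture-24833`) to pass from an ARBITRARY Haar measure on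
`H_∞`∕`G′_∞` to the product-measure convention of (PROD-QUOT-H∕G′) (every Haar measure is `haarScalarFactor •` the product one, Mathlib `isMulLeftInvariant_eq_smul`).
HONEST LABEL: pure measure theory; pays nothing by itself.

## References
* [DeitmarEchterhoff2014] A. Deitmar, S. Echterhoff, *Principles of Harmonic Analysis*, 2nd ed. (2014), Thm. 1.5.3.
* [Folland1995] G. B. Folland, *A Course in Abstract Harmonic Analysis* (1995), §2.6 Thm. 2.49, (2.52).
-/

set_option autoImplicit false

noncomputable section

open MeasureTheory MeasureTheory.Measure Topology
open scoped NNReal ENNReal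

namespace Literature.MeasureTheory.Group

section Scaling

variable {G : Type*} [Group G] [TopologicalSpace G] [IsTopologicalGroup G] [LocallyCompactSpace G] [SecondCountableTopology G] [T2Space G]
  [MeasurableSpace G] [BorelSpace G]
  (H : Subgroup G) (hH : IsClosed (H : Set G)) [MeasurableSpace (G ⧸ H)] [BorelSpace (G ⧸ H)]
  (ρ : Measure H) [ρ.IsHaarMeasure] [ρ.IsInvInvariant]
  (ν : Measure G) [ν.IsHaarMeasure] [ν.IsMulRightInvariant]

/-- **`(c • ν) ∕ ρ = c • (ν ∕ ρ)`**: the canonical quotient measure is linear in the Haar measure of `G` (`0 < c < ∞`; the quotient measure of `c • ν` is an invariant Radon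
measure, hence `u •` that of `ν` with `u` its unfolding constant, and Weil's formula on the indicator of a positive compact `K` reads `u · ν(K) = c · ν(K)`).
[cite: DeitmarEchterhoff2014, Thm. 1.5.3] [cite: Folland1995, §2.6 (2.52)] -/
theorem quotientMeasure_smul_measure {c : ℝ≥0∞} (hc : c ≠ 0) (hc' : c ≠ ⊤) :
    haveI := IsHaarMeasure.smul ν hc hc'
    quotientMeasure H ρ hH (c • ν) = c • quotientMeasure H ρ hH ν := by
  haveI := IsHaarMeasure.smul ν hc hc'
  haveI : IsClosed (H : Set G) := hH
  haveI : LocallyCompactSpace H := hH.isClosedEmbedding_subtypeVal.locallyCompactSpace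
  have hQ := eq_unfoldingConstant_smul_quotientMeasure H ρ ν (quotientMeasure H ρ hH (c • ν))
  obtain ⟨K⟩ := (inferInstance : Nonempty (TopologicalSpace.PositiveCompacts G))
  have hKpos : 0 < ν K := measure_pos_of_nonempty_interior ν K.interior_nonempty
  have hKfin : ν K < ⊤ := K.isCompact.measure_lt_top
  have hf : Measurable ((K : Set G).indicator (1 : G → ℝ≥0∞)) := measurable_one.indicator K.isCompact.measurableSet
  have h1 := lintegral_fiberLIntegral_quotientMeasure H ρ (c • ν) hf
  have h2 := lintegral_fiberLIntegral_eq_mul_lintegral H ρ (quotientMeasure H ρ hH (c • ν)) ν hf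
  rw [h2, lintegral_indicator_one K.isCompact.measurableSet, lintegral_smul_measure, lintegral_indicator_one K.isCompact.measurableSet, smul_eq_mul] at h1
  -- `u * ν K = c * ν K`
  have hu : (unfoldingConstant H ρ (quotientMeasure H ρ hH (c • ν)) ν : ℝ≥0∞) = c := (ENNReal.mul_left_inj hKpos.ne' hKfin.ne).mp h1
  rw [hQ, ENNReal.smul_def, hu]

/-- `∫⁻ F d((c • ν) ∕ ρ) = c · ∫⁻ F d(ν ∕ ρ)`. [cite: DeitmarEchterhoff2014, Thm. 1.5.3] -/
theorem lintegral_quotientMeasure_smul_measure {c : ℝ≥0∞} (hc : c ≠ 0) (hc' : c ≠ ⊤) (F : G ⧸ H → ℝ≥0∞) :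
    haveI := IsHaarMeasure.smul ν hc hc'
    ∫⁻ x, F x ∂(quotientMeasure H ρ hH (c • ν)) = c * ∫⁻ x, F x ∂(quotientMeasure H ρ hH ν) := by
  haveI := IsHaarMeasure.smul ν hc hc'
  rw [quotientMeasure_smul_measure H hH ρ ν hc hc', lintegral_smul_measure, smul_eq_mul]

/-- `∫ F d((c • ν) ∕ ρ) = c.toReal • ∫ F d(ν ∕ ρ)` (Bochner). [cite: DeitmarEchterhoff2014, Thm. 1.5.3] -/
theorem integral_quotientMeasure_smul_measure {E : Type*} [NormedAddCommGroup E] [NormedSpace ℝ E] {c : ℝ≥0∞} (hc : c ≠ 0) (hc' : c ≠ ⊤) (F : G ⧸ H → E) :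
    haveI := IsHaarMeasure.smul ν hc hc'
    ∫ x, F x ∂(quotientMeasure H ρ hH (c • ν)) = c.toReal • ∫ x, F x ∂(quotientMeasure H ρ hH ν) := by
  haveI := IsHaarMeasure.smul ν hc hc'
  rw [quotientMeasure_smul_measure H hH ρ ν hc hc', integral_smul_measure]

end Scaling

end Literature.MeasureTheory.Group

end
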